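import Summits.AtomisticToContinuum.HydrodynamicLimit.Theorems.CollisionIsometryCLTAdaptedWeightCLTLine

/-!
# The route consumes the crux `AdaptedWeightCLT` only PRE-SHOCK — negative bookkeeping for its classification

Negative-lane support file for the crux `CollisionIsometryCLT.AdaptedWeightCLT` (stmt-AtomisticToContinuum-14868, the
rev-12 TIME-LOCAL form), from the standing disprover's `Cruxes/AdaptedWeightCLT/Disproof.lean` §1c (cycle 3,
refuter-cdisprove-stmt-AtomisticToContinuum-14868-0).

Since rev 12 the route's target `FastMomentRelaxationPreShock` is conditioned, exactly like the conjunct, on a classical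
hs-Euler solution on `[0,T)` with LLN-matching local Gibbs data and claimed for `0 < t < T` inside the dilute chamber
`2ρσ³ < η₁`; the deciding theorem `closes` feeds the crux ONLY there (its H2 input is component (i) of
`AprioriBoundsPreShock`).  The crux itself is claimed for ALL `t > 0` and all flows, with no Euler data.  This file
types the consumed part, `AdaptedWeightCLTPreShock` (the crux conditioned like the target; H1 written with the landed
line vocabulary's `iprF`, definitionally the crux's inlined `let M; let ipr`), and records, in negative dress (no
Theses statement is concluded positively):

* `adaptedWeightCLT_false_of_not_preShock` — `¬ AdaptedWeightCLTPreShock → ¬ AdaptedWeightCLT` (the crux implies its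
  pre-shock conditioning, pure logic);
* `not_preShock_of_not_target` — `DiffuseBackwardInfluence → AprioriBoundsPreShock → ¬ FastMomentRelaxationPreShock →
  ¬ AdaptedWeightCLTPreShock`: the pre-shock form ALREADY produces the target through the kinetic engine glue
  (`σ₀ := min σ₁ (min σ₂ σ₃)`, `η₁ := min η₂ η₃`), so the post-shock / unconditioned surplus of the crux is not
  load-bearing for the route;
* `not_preShock_of_not_hydrodynamicLimit` — the same through `MacroClosure` to the sub-problem Statement.

Use (for planners and refuters): a counterexample to the crux living at `t ≥ T` — the one physical candidate being
sub-block Kelvin–Helmholtz / Richtmyer–Meshkov Reynolds stress after shock formation, with H1 and H2(t) intact — misses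
`AdaptedWeightCLTPreShock`; such a refutation is `refuted-misstated` with repaired statement C′ = `AdaptedWeightCLTPreShock`,
and by the two lemmas below the route's `KineticEngineGlue`, `Assembly` and `closes` survive the repair verbatim.
-/

namespace Summit.AtomisticToContinuum.HydrodynamicLimit.Theorems.AdaptedWeightCLTNegative

open scoped BigOperators Topology Classical MeasureTheory ENNReal InnerProductSpace
open Filter Set MeasureTheory
open Summit.AtomisticToContinuum.HydrodynamicLimit.Theses.CollisionIsometryCLT
open Summit.AtomisticToContinuum.HydrodynamicLimit.Theorems.ContactSourceDuhamel (iprF)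

/-- `C′`: the crux `AdaptedWeightCLT` conditioned like the route's target — for all nice profiles `∃ σ₀ ∃ η₁ ∀ σ < σ₀
∀ Φ`, H1 (diffuse rows, the crux's first hypothesis with `iprF` for its `let M; let ipr`) → for every classical hs-Euler
solution `(ρ,u,θ)` on `[0,T)` with LLN-matching local Gibbs data → kernels → for every `0 < t < T` with the solution dilute
on `[0,t]` (`2ρσ³ < η₁`) → H2 on `[0,t]` → the kinetic closure on `[0,t]` (the crux's conclusion verbatim).
(A CANDIDATE RESTATEMENT of a route item, deliberately NOT tagged as a literature fact: it is nobody's theorem and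
nobody's conjecture in print; it exists so that the two bookkeeping lemmas below can name it.) -/
def AdaptedWeightCLTPreShock : Prop :=
  ∀ (a₀ θ₀ : (UnitAddTorus (Fin 3)) → ℝ) (u₀ : (UnitAddTorus (Fin 3)) → (EuclideanSpace ℝ (Fin 3))), Continuous a₀ → Continuous θ₀ → Continuous u₀ → (∀ x, 0 < a₀ x) → (∀ x, 0 < θ₀ x) → ∃ σ₀ : ℝ, 0 < σ₀ ∧ ∃ η₁ : ℝ, 0 < η₁ ∧ ∀ σ : ℝ, 0 < σ → σ < σ₀ → ∀ Φ : (N : ℕ) → Literature.Analysis.FluidPDE.HardSphereFlow (Literature.Analysis.FluidPDE.Torus.geometry (Fin 3)) (Literature.MathematicalPhysics.KineticTheory.hsDiameter σ N) (N + 1), (∀ Δ : ℕ → ℝ, (∀ N, 0 < Δ N) → Tendsto Δ atTop (𝓝 0) → Tendsto (fun N : ℕ => Δ N * ((N + 1 : ℕ) : ℝ) ^ ((1 : ℝ) / 3)) atTop atTop → ∀ t : ℝ, 0 < t → Tendsto (fun N : ℕ => ∫⁻ z, ENNReal.ofReal (iprF σ N ((Φ N).flow (t - Δ N) z) (Δ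 N)) ∂(Literature.MathematicalPhysics.KineticTheory.localGibbsLaw σ a₀ u₀ θ₀ N (Φ N))) atTop (𝓝 0)) → ∀ (T : ℝ) (ρ θ : ℝ → (UnitAddTorus (Fin 3)) → ℝ) (u : ℝ → (UnitAddTorus (Fin 3)) → (EuclideanSpace ℝ (Fin 3))), Literature.MathematicalPhysics.KineticTheory.IsHardSphereEulerSolution σ T ρ u θ → Literature.MathematicalPhysics.KineticTheory.TendstoHydroFieldsAt (fun N => Literature.MathematicalPhysics.KineticTheory.localGibbsLaw σ a₀ u₀ θ₀ N (Φ N)) Φ ρ u θ 0 → ∀ (γ C : ℝ) (φ : ℕ → (UnitAddTorus (Fin 3)) → ℝ), 0 < γ → γ ≤ 1 / 15 → ((∀ N, Literature.Analysis.FunctionSpaces.Torus.IsSmooth (φ N)) ∧ (∀ N y, 0 ≤ φ N y) ∧ (∀ N, ∫ y, φ N y = 1) ∧ (∀ (N : ℕ) y, ((N : ℝ) + 1) ^ (-γ) ≤ Literature.Analysis.FluidPDE.Torus.euclidDist y 0 → φ N y = 0) ∧ (∀ (N : ℕ) y, φ N y ≤ C * ((N : ℝ) + 1) ^ (3 * γ))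 ∧ (∀ (N : ℕ) y, ‖Literature.Analysis.FunctionSpaces.Torus.gradient (φ N) y‖ ≤ C * ((N : ℝ) + 1) ^ (4 * γ))) → let ρb := fun (N : ℕ) (s : ℝ) z (x : UnitAddTorus (Fin 3)) => Literature.MathematicalPhysics.KineticTheory.empiricalDensityField ((Φ N).flow s z) (fun y => φ N (y - x)); let mb := fun (N : ℕ) (s : ℝ) z (x : UnitAddTorus (Fin 3)) => Literature.MathematicalPhysics.KineticTheory.empiricalMomentumField ((Φ N).flow s z) (fun y => φ N (y - x)); let ub := fun (N : ℕ) (s : ℝ) z (x : UnitAddTorus (Fin 3)) => (ρb N s z x)⁻¹ • mb N s z x; let D := fun (N : ℕ) (s : ℝ) z (x : UnitAddTorus (Fin 3)) (j k : Fin 3) => (∫ y, φ N (y.1 - x) * ((y.2 j - ub N s z x j) * (y.2 k - ub N s z x k)) ∂(Literature.Analysis.FluidPDE.empiricalMeasure ((Φ N).flow s z))) - (if j = k then (∑ l : Fin 3, ∫ y, φ N (y.1 - x) * (y.2 l - ub N s z x l) ^ 2 ∂(Literature.Analysis.FluidPDE.empiricalMeasure ((Φ N).flow s z))) / 3 else 0);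 let q := fun (N : ℕ) (s : ℝ) z (x : UnitAddTorus (Fin 3)) => ∫ y, (φ N (y.1 - x) * ‖y.2 - ub N s z x‖ ^ 2 / 2) • (y.2 - ub N s z x) ∂(Literature.Analysis.FluidPDE.empiricalMeasure ((Φ N).flow s z)); ∀ t : ℝ, 0 < t → t < T → (∀ s ∈ Icc 0 t, ∀ x, 2 * ρ s x * σ ^ 3 < η₁) → (∃ lam Cexp : ℝ, 0 < lam ∧ Tendsto (fun N : ℕ => Literature.MathematicalPhysics.KineticTheory.localGibbsLaw σ a₀ u₀ θ₀ N (Φ N) {z | Cexp < ∫ s in Icc 0 t, ∫ y, Real.exp (lam * ‖y.2‖ ^ 2) ∂(Literature.Analysis.FluidPDE.empiricalMeasure ((Φ N).flow s z))}) atTop (𝓝 0)) → ∀ δ : ℝ, 0 < δ → Tendsto (fun N : ℕ => Literature.MathematicalPhysics.KineticTheory.localGibbsLaw σ a₀ u₀ θ₀ N (Φ N) {z | δ < ∫ s in Icc 0 t, ∫ x, ((∑ j, ∑ k, D N s z x j k ^ 2) + ‖q N s z x‖ ^ 2)}) atTop (𝓝 0)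

/-- The crux implies its pre-shock conditioning (pure logic: `η₁ := 1`; Euler data, LLN and chamber ignored),
contrapositive form. [folklore] -/
theorem adaptedWeightCLT_false_of_not_preShock (hn : ¬ AdaptedWeightCLTPreShock) : ¬ AdaptedWeightCLT := by
  intro h
  apply hn
  intro a₀ θ₀ u₀ ha hθ hu ha0 hθ0
  obtain ⟨σ₀, hσ₀, H⟩ := h a₀ θ₀ u₀ ha hθ hu ha0 hθ0
  refine ⟨σ₀, hσ₀, 1, one_pos, fun σ hσ hσ' Φ h1 T ρ θ u _ _ γ C φ hγ hγ' hadm => ?_⟩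
  intro ρb mb ub D q t ht _ _ h2 δ hδ
  exact H σ hσ hσ' Φ h1 γ C φ hγ hγ' hadm t ht h2 δ hδ

/-- The pre-shock form already runs the kinetic engine glue: with `DiffuseBackwardInfluence` and
`AprioriBoundsPreShock` it yields the target `FastMomentRelaxationPreShock` (the inline block of `closes` with
`AdaptedWeightCLTPreShock` in place of the crux; `σ₀ := min σ₁ (min σ₂ σ₃)`, `η₁ := min η₂ η₃`) — stated as the
contrapositive, so that nothing positive is concluded about a route item. [folklore] -/
theorem not_preShock_of_not_target (hD : DiffuseBackwardInfluence) (h₃ : AprioriBoundsPreShock)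
    (hF : ¬ FastMomentRelaxationPreShock) : ¬ AdaptedWeightCLTPreShock := by
  intro hC
  apply hF
  intro a₀ θ₀ u₀ ha hθ hu hapos hθpos
  obtain ⟨σ₁, hσ₁, H1⟩ := hD a₀ θ₀ u₀ ha hθ hu hapos hθpos
  obtain ⟨σ₂, hσ₂, η₂, hη₂, H2⟩ := hC a₀ θ₀ u₀ ha hθ hu hapos hθpos
  obtain ⟨σ₃, hσ₃, η₃, hη₃, H3⟩ := h₃ a₀ θ₀ u₀ ha hθ hu hapos hθpos
  refine ⟨min σ₁ (min σ₂ σ₃), lt_min hσ₁ (lt_min hσ₂ hσ₃), min η₂ η₃, lt_min hη₂ hη₃, ?_⟩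
  intro σ hσ hσlt T ρ θ u hsol Φ hLLN
  have h1 := H1 σ hσ (lt_of_lt_of_le hσlt (min_le_left _ _))
  have h2 := H2 σ hσ (lt_of_lt_of_le hσlt ((min_le_right _ _).trans (min_le_left _ _)))
  have h3 := H3 σ hσ (lt_of_lt_of_le hσlt ((min_le_right _ _).trans (min_le_right _ _))) T ρ θ u hsol Φ hLLN
  intro γ C φ hγ hγ' hadm ρb mb ub D q t ht htT hdil δ hδ
  have hdil₂ : ∀ s ∈ Icc 0 t, ∀ x, 2 * ρ s x * σ ^ 3 < η₂ :=
    fun s hs x => lt_of_lt_of_le (hdil s hs x) (min_le_left _ _)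
  have hdil₃ : ∀ s ∈ Icc 0 t, ∀ x, 2 * ρ s x * σ ^ 3 < η₃ :=
    fun s hs x => lt_of_lt_of_le (hdil s hs x) (min_le_right _ _)
  exact h2 Φ (h1 Φ) T ρ θ u hsol hLLN γ C φ hγ hγ' hadm t ht htT hdil₂ (h3 t ht htT hdil₃).1 δ hδ

/-- … and through the interface crux `MacroClosure` to the sub-problem Statement (`closes` re-run with the pre-shock
form), contrapositive form. [folklore] -/
theorem not_preShock_of_not_hydrodynamicLimit (hD : DiffuseBackwardInfluence) (h₃ : AprioriBoundsPreShock)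
    (h₂ : CollisionalTransferLocality) (hM : MacroClosure) (hH : ¬ _root_.HydrodynamicLimit) :
    ¬ AdaptedWeightCLTPreShock :=
  fun hC => (not_preShock_of_not_target hD h₃ fun hF => hH (hM h₂ h₃ hF)) hC

end Summit.AtomisticToContinuum.HydrodynamicLimit.Theorems.AdaptedWeightCLTNegative
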